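/-
Copyright: lit-balaban Phase-2 proof seat p09 (gen 9).  Statement-level skeleton of a published paper; no proof claims beyond what
the kernel checks below.
-/
import Literature.MathematicalPhysics.QuantumFieldTheory.BalabanImbrieJaffe1984to88.BIJ88Eq541Base0

/-!
# [BalabanImbrieJaffe1985] (4.4.4) p. 312: `Q_k𝒟_k = 0` — the propagator `𝒟_k = Σ_{j<k} H_jC^{(j)}H_j*` takes values in fields with
zero `k`-block averages; hence `Q_kT_k = 0` for the smoothing operator `T_k = 𝒟_k∂*Q^{e*}_k` of (4.5.4) / [BalabanImbrieJaffe1988] (5.4.1)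

T. Bałaban, J. Imbrie, A. Jaffe, *Renormalization of the Higgs model: minimizers, propagators and the stability of mean field theory*,
Commun. Math. Phys. **97** (1985) 299–329 [BalabanImbrieJaffe1985]; *Effective action and cluster properties of the abelian Higgs model*,
Commun. Math. Phys. **114** (1988) 257–315 [BalabanImbrieJaffe1988].  Rows **C1.Eq4.4.4** (the object), **C1.Eq7.3.1-7.3.2** (where the
structural fact is consumed: the line sums of `T_kg` in the second printed form of (7.3.2), p11's `BIJ85Claim73SecondForm.SecClosedIdx.hT`)
of the lit-balaban skeleton (owner r15, referee ref-5).

THE PRINTED TEXT, verbatim.  p. 312 [PDF 14]: *"Rather, we define a propagator 𝒟_k in terms of minimizers H_j and the covariance operators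
C^{(j)} of Sect. 4.3. Let 𝒟_k = Σ_{j=0}^{k−1} H_jC^{(j)}H_j*. (4.4.4) Here the transformations H_j are now defined by the same formulas as
(4.4.2); however, they act on the η = L^{−k} lattice instead of the L^{−j} lattice and they involve j order averages Q_j. Similarly the
propagators C^{(j)} are defined by the formula (4.3.3) but on the L^jη = L^{j−k} lattice, rather than on the unit lattice. They still involve
one-step averages Q."*; p. 311 [PDF 13], (4.3.3): the unit-lattice propagator `C^{(k)}` is the covariance of the Gaussian measure carrying
*"δ(QB)δ_{Ax}(B)"* — it acts on, and takes values in, the one-step constraint subspace `QB = 0`, `B` axial; p. 310 [PDF 12], after (4.1.5):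
*"by definition Q_kH_{k,Ax}B = B"* (and `Q_kH_kB = B` for the Landau minimizer (4.4.2), p11's `QcE_HkE`).

WHAT THIS FILE PROVES (0 `sorry`, theorems only — proof lane; every `d`, every torus of the series `Balaban1983to89.Setup`, standing range
`k ≤ m + K`, lattice factor `c ≠ 0`, weight `w > 0`; the operators OF RECORD: p11's `HkE`/`CE`/`DkE` (`BIJ85Prop522Torus`), `QcE`
(`BIJ85Prop521Torus`), p31's `TkF` (`BIJ88Eq541Base0`)):
* `bondAvgIter_HkE_of_mem_Wstep` — for `B ∈ Wstep P j` (= `δ(QB)δ_{Ax}(B)`) and every `i`, `Q_{j+1+i}(H_jB) = 0`: the `(j+1+i)`-fold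
  straight-line average of the Landau minimizer of a one-step-fluctuation datum vanishes (`Q_jH_j = I`, then `Q(B) = 0`, then linearity).
* `QcE_HkE_CE_eq_zero` — `Q_k(H_jC^{(j)}X) = 0` for `j < k` (the range of `C^{(j)}` lies in `Wstep P j`: p30's `axialPropagator_mem`).
* **`QcE_DkE_eq_zero`** — `Q_k(𝒟_kA) = 0` for every `A`, and **`QcE_comp_DkE`** — `Q_k ∘ 𝒟_k = 0` as linear maps ((4.4.4) summed).
* **`bondAvgIter_TkF_eq_zero`** — `Q_k(T_kg) = 0` for every unit-lattice plaquette function `g`: the (4.5.4)/(5.4.1) correction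
  `T_kg = 𝒟_k∂*Q^{e*}_kg` has zero `k`-block straight-line averages on every unit bond.  Reading: in the linearisation
  `u_k = Q^{s*}_kv − T_k(∂v)` of (4.5.4) the block average `Q_ku_k` returns `Q_kQ^{s*}_kv = v` EXACTLY; the unit-bond line sums of `T_kg`
  that enter the second printed form of (7.3.2) (p11's `lineSumIter`, a CORNER line of the block) therefore have zero mean over the
  `L^{kd}` parallel translates making up `Q_k` — the located constant `K_T` of `SecClosedIdx.hT` measures a pure fluctuation.
HONEST SCOPE.  An exact algebraic identity for the operators of record; no estimate is proved here (the k-uniform bound `K_T` of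
`SecClosedIdx.hT` is NOT addressed).  Real (Lie-algebra) fields, `U = 1`, torus, standing range.

statement-level skeleton of published theorems with citation tags; proofs where landed; nothing here is a claim about the Yang–Mills mass gap
-/

open scoped BigOperators RealInnerProductSpace
open Finset

namespace Literature.MathematicalPhysics.QuantumFieldTheory.BalabanImbrieJaffe1984to88.BIJ85CurlyDkBlockAverage

open Balaban1983to89 hiding Site Plaq
open Balaban1983to89.LatticeFieldCalculus (bondAvg bondAvgIter)
open BIJ85AxialPropagator411 (BondSpace toE curlOp bondAvg_zero)
open BIJ85Prop521Torus (CoarseSpace toEj QcE QcE_apply Wstep mem_Wstep)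
open BIJ85Prop521Proof (axialPropagator_mem)
open BIJ85Prop522Torus (HkE CE DkE QcE_HkE)
open BIJ85Sigma421Torus (toU QesOp)
open BIJ88Eq541Base0 (TkF TkF_apply)

variable {P : Params}

/-- kernel: one more straight-line average, definitionally. [cite: BalabanImbrieJaffe1985, (2.13) p.303] -/
private theorem bondAvgIter_succ' (n : ℕ) (A : VecField P 0 ℝ) : bondAvgIter (n + 1) A = bondAvg (bondAvgIter n A) := rfl

/-- kernel: `Q_j` of record read on functions — `Q_jA = ι_j(bondAvgIter j A)`, so `bondAvgIter j A = ι_j⁻¹(Q_jA)`.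
[cite: BalabanImbrieJaffe1985, (2.13) p.303] -/
theorem bondAvgIter_eq_symm_QcE (j : ℕ) (A : BondSpace P) :
    bondAvgIter j (WithLp.ofLp A) = (toEj P j).symm (QcE P j A) := by
  rw [QcE_apply, LinearEquiv.symm_apply_apply]
  rfl

/-- **`Q_{j+1+i}(H_jB) = 0` for a one-step-fluctuation datum** `B ∈ δ(QB)δ_{Ax}(B)`: `Q_jH_jB = B` ((4.1.5)/(4.4.2)), then `QB = 0`, then
`Q(0) = 0`. [cite: BalabanImbrieJaffe1985, (4.3.3) p.311] -/
theorem bondAvgIter_HkE_of_mem_Wstep {j : ℕ} (hj : j ≤ P.m + P.K) {c : ℝ} (hc : c ≠ 0) {w : ℝ} (hw : 0 < w)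
    {B : CoarseSpace P j} (hB : B ∈ Wstep P j) :
    ∀ i : ℕ, bondAvgIter (j + 1 + i) (WithLp.ofLp (HkE P w c j B)) = 0 := by
  have h0 : bondAvgIter (j + 1) (WithLp.ofLp (HkE P w c j B)) = 0 := by
    rw [bondAvgIter_succ', bondAvgIter_eq_symm_QcE, QcE_HkE hj hc hw]
    exact ((mem_Wstep j B).1 hB).1
  intro i
  induction i with
  | zero => simpa using h0
  | succ i ih =>
    rw [show j + 1 + (i + 1) = (j + 1 + i) + 1 by ring, bondAvgIter_succ', ih]
    exact bondAvg_zero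

/-- **`Q_k(H_jC^{(j)}X) = 0` for `j < k`**: the range of `C^{(j)}` ((4.3.3)) lies in `δ(QB)δ_{Ax}(B)`.
[cite: BalabanImbrieJaffe1985, (4.3.3) p.311] -/
theorem QcE_HkE_CE_eq_zero {j k : ℕ} (hjk : j < k) (hk : k ≤ P.m + P.K + 1) {c : ℝ} (hc : c ≠ 0) {w : ℝ} (hw : 0 < w)
    (X : CoarseSpace P j) : QcE P k (HkE P w c j (CE P w c j X)) = 0 := by
  have hj : j ≤ P.m + P.K := by omega
  have hmem : CE P w c j X ∈ Wstep P j := by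
    unfold CE
    exact axialPropagator_mem _ _ _
  obtain ⟨i, rfl⟩ : ∃ i, k = j + 1 + i := ⟨k - (j + 1), by omega⟩
  have h := bondAvgIter_HkE_of_mem_Wstep hj hc hw hmem i
  rw [bondAvgIter_eq_symm_QcE] at h
  simpa using h

/-- **`Q_k𝒟_kA = 0`** — (4.4.4) summed over `j < k`. [cite: BalabanImbrieJaffe1985, (4.4.4) p.312] -/
theorem QcE_DkE_eq_zero {k : ℕ} (hk : k ≤ P.m + P.K + 1) {c : ℝ} (hc : c ≠ 0) {w : ℝ} (hw : 0 < w) (A : BondSpace P) :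
    QcE P k (DkE P w c k A) = 0 := by
  simp only [DkE, LinearMap.sum_apply, LinearMap.coe_comp, Function.comp_apply, map_sum]
  exact Finset.sum_eq_zero fun j hj => QcE_HkE_CE_eq_zero (Finset.mem_range.1 hj) hk hc hw _

/-- **`Q_k ∘ 𝒟_k = 0`** as linear maps. [cite: BalabanImbrieJaffe1985, (4.4.4) p.312] -/
theorem QcE_comp_DkE {k : ℕ} (hk : k ≤ P.m + P.K + 1) {c : ℝ} (hc : c ≠ 0) {w : ℝ} (hw : 0 < w) :
    QcE P k ∘ₗ DkE P w c k = 0 :=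
  LinearMap.ext fun A => QcE_DkE_eq_zero hk hc hw A

/-- **`Q_k(T_kg) = 0`**: the (4.5.4) / (5.4.1) correction `T_kg = 𝒟_k∂*Q^{e*}_kg` has zero `k`-block straight-line averages, for every
unit-lattice plaquette function `g` (weights `w > 0`, `η ≠ 0`; `k ≤ m + K + 1`). [cite: BalabanImbrieJaffe1988, (5.4.1) p.281] -/
theorem bondAvgIter_TkF_eq_zero (hd : 2 ≤ P.d) {k : ℕ} (hk : k ≤ P.m + P.K + 1) {w η : ℝ} (hw : 0 < w) (hη : η ≠ 0)
    (g : Balaban1983to89.Plaq P k → ℝ) : bondAvgIter k (TkF P hd w η k g) = 0 := by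
  have hT : TkF P hd w η k g = WithLp.ofLp (DkE P w η⁻¹ k
      (LinearMap.adjoint (curlOp (P := P) w η⁻¹) (QesOp (P := P) hd w k (toU P k g)))) := by
    funext b
    exact TkF_apply hd w η k g b
  rw [hT, bondAvgIter_eq_symm_QcE, QcE_DkE_eq_zero hk (inv_ne_zero hη) hw, map_zero]

end Literature.MathematicalPhysics.QuantumFieldTheory.BalabanImbrieJaffe1984to88.BIJ85CurlyDkBlockAverage
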